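import Literature.AlgebraicGeometry.Motives.SupersingularAbelianVariety
import Literature.AlgebraicGeometry.Motives.AbelianVarietyWeights
import Literature.AlgebraicGeometry.Motives.VarietiesProjectiveSpaceProofs
import HarnessLib

/-!
# Lefschetz classes: the degree-`0` and top-degree cases, functoriality, and the
# zero-dimensional case of Lenstra–Zarhin

Sibling file of `Literature.AlgebraicGeometry.Motives.SupersingularAbelianVariety`, which records
the named fact `LenstraZarhin1993_supersingular_lefschetzClasses_eq_top` (Lenstra–Zarhin 1993, §1,
p. 179: on a supersingular abelian variety all even-degree cohomology classes are algebraic, in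
fact Lefschetz classes) relative to a Weil cohomology theory `W` (Kleiman 1968, §1.2) and the
`K`-span `W.lefschetzClasses X r ⊆ H²ʳ(X)` of the `r`-th powers of `K`-combinations of divisor
classes (Milne 2009, §1.3). This file proves, formally in the axioms of `WeilCohomology`, the
parts of that statement and the reduction steps that do not depend on the endomorphism ring of a
supersingular elliptic curve:

* `WeilCohomology.lefschetzClasses_zero_eq_top`: `H⁰(X) = K · 1` consists of Lefschetz classes
  (`1 = D⁰`; `H⁰(X) = K · 1` by Poincaré duality, `exists_eq_smul_one`);
* `WeilCohomology.lefschetzClasses_eq_top_of_lt`: `H²ʳ(X) = 0` for `r > dim X` (axiom (A));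
* `WeilCohomology.lefschetzClasses_one_eq`: in degree `2` the Lefschetz classes are exactly the
  `K`-span of the divisor classes (`D¹ = 1 ∪ D = D`);
* `WeilCohomology.pullback_pow_eq_pow_pullback`, `map_algebraicClasses_le`,
  `map_lefschetzClasses_le`, `lefschetzClasses_eq_top_of_surjective`: `f* (Dʳ) = (f* D)ʳ`,
  pull-backs of algebraic classes are algebraic (axiom (C-lite)
  `pullback_ratAlgebraicClasses_le`), hence pull-backs of Lefschetz classes are Lefschetz
  classes, and if `f* : H²ʳ(Y) → H²ʳ(X)` is onto and `H²ʳ(Y)` consists of Lefschetz classes then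
  so does `H²ʳ(X)` (the reduction along an isogeny `A → Eᵍ`);
* `LenstraZarhin1993_supersingular_lefschetzClasses_eq_top_of_dim_eq_zero` and
  `lefschetzClasses_abelianVariety_eq_top_of_eq_zero_or_lt`: the fact holds for zero-dimensional
  abelian varieties, and for every abelian variety in the degrees `r = 0` and `r > dim A`;
* `WeilCohomology.hyperplaneClass_mem_algebraicClasses`, `lefschetzClasses_top_eq_top`: a
  hyperplane class `η` is a `K`-combination of divisor classes and `ηⁿ ≠ 0` spans the
  one-dimensional `H²ⁿ(X)` (`n = dim X`), so the top degree consists of Lefschetz classes; hence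
  `LenstraZarhin1993_supersingular_lefschetzClasses_eq_top_of_dim_le_one`: **the fact holds for
  abelian varieties of dimension `≤ 1`** (for a supersingular elliptic curve `H² = H^{top}`; no
  information on `End E` is needed);
* `WeilCohomology.surjective_pullback_of_comp_eq_pow`,
  `lefschetzClasses_eq_top_of_comp_eq_pow`: if `k`-morphisms `f : A → B`, `g : B → A` of abelian
  varieties satisfy `g ∘ f = n_A` with `n ≠ 0` (an isogeny with a quasi-inverse, Mumford §19,
  remark before Thm. 1), then `f* : H•(B) → H•(A)` is onto (`n_A* = nⁱ` on `Hⁱ(A)`,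
  `pullback_pow_eq_pow_smul`), so Lefschetz classes transfer from `B` to `A` — the isogeny step
  `A ∼ Eᵍ` of Lenstra–Zarhin's remark whenever the isogeny admits a quasi-inverse.

Everything is formal in the axioms of `WeilCohomology` (`one_cup`, `map_one`, `map_cup`,
`finite_obj`, `subsingleton_obj`, `bijective_trace`, `isPerfPair_cupPairing`,
`pullback_ratAlgebraicClasses_le`, `isHyperplaneClass_nonempty`, `trace_pow_of_isHyperplaneClass`,
and, through `pullback_pow_eq_pow_smul`, the Künneth axioms) together with the discharged facts
`AbelianVariety.isSmoothProjective_holds` and `isSmoothProjective_projectiveSpace_holds`; no named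
fact is introduced.

## References

* [LenstraZarhin1993] H. W. Lenstra, Jr., Yu. G. Zarhin, *The Tate conjecture for almost ordinary
  abelian varieties over finite fields*, in: Advances in Number Theory (CNTA III, Kingston 1991),
  OUP 1993, 179–194; §1, p. 179.
* [Milne2009RationalTate] J. S. Milne, *Rational Tate classes*, Moscow Math. J. 9 (2009), §1.3.
* [Kleiman1968] S. Kleiman, *Algebraic cycles and the Weil conjectures*, in: Dix exposés sur la
  cohomologie des schémas (1968), §1.2, Appendix 2A.
* [MumfordAV1970] D. Mumford, *Abelian Varieties* (1970), §19, remark before Thm. 1 (p. 169).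
-/

noncomputable section

universe u v

open CategoryTheory AlgebraicGeometry

namespace Literature.AlgebraicGeometry.Motives

namespace WeilCohomology

variable {k : Type u} [Field k] {K : Type v} [Field K] [CharZero K] (W : WeilCohomology k K)

/-! ## Degree `0` and degrees above `2 dim X` -/

/-- **`H⁰(X)` consists of Lefschetz classes**: `W.lefschetzClasses X 0 = ⊤` for a smooth
projective `X`, since `H⁰(X) = K · 1` (`exists_eq_smul_one`) and `1 = D⁰` for the divisor
combination `D = 0` (Milne 2009, §1.3: the Lefschetz classes form a `ℚ`-subalgebra, containing
`1`). [cite: Milne2009RationalTate, §1.3] -/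
theorem lefschetzClasses_zero_eq_top {n : ℕ} {X : SchemeOver k} (hX : IsSmoothProjective n X) :
    W.lefschetzClasses X 0 = ⊤ := by
  rw [eq_top_iff]
  rintro x -
  obtain ⟨c, rfl⟩ := W.exists_eq_smul_one hX x
  refine Submodule.smul_mem _ c ?_
  have h := W.pow_mem_lefschetzClasses X (D := 0) (zero_mem _) 0
  rwa [W.pow_zero] at h

/-- **No cohomology above the top degree**: `W.lefschetzClasses X r = ⊤` for `r > dim X`, as
`H²ʳ(X) = 0` (Kleiman 1968, §1.2 (A)). [cite: Kleiman1968, §1.2 (A)] -/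
theorem lefschetzClasses_eq_top_of_lt {n : ℕ} {X : SchemeOver k} (hX : IsSmoothProjective n X)
    {r : ℕ} (h : n < r) : W.lefschetzClasses X r = ⊤ := by
  haveI := W.subsingleton_obj hX (i := 2 * r) (by omega)
  rw [eq_top_iff]
  rintro x -
  rw [Subsingleton.elim x 0]
  exact zero_mem _

/-- In degree `2` the Lefschetz classes are the `K`-span of the divisor classes:
`W.lefschetzClasses X 1 = K · A¹(X)`, because `D¹ = 1 ∪ D = D` (`one_cup`).
[cite: Milne2009RationalTate, §1.3] -/
theorem lefschetzClasses_one_eq {n : ℕ} {X : SchemeOver k} (hX : IsSmoothProjective n X) :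
    W.lefschetzClasses X 1 = W.algebraicClasses X 1 := by
  have hpow : ∀ D : W.obj X 2, W.pow X D 1 = D := fun D ↦ by
    rw [W.pow_succ, W.pow_zero]
    exact W.one_cup hX _ D
  apply le_antisymm
  · refine Submodule.span_le.2 ?_
    rintro _ ⟨⟨D, hD⟩, rfl⟩
    show W.pow X D 1 ∈ W.algebraicClasses X 1
    rw [hpow]
    exact hD
  · intro D hD
    simpa only [hpow] using W.pow_mem_lefschetzClasses X hD 1

/-! ## Functoriality -/

/-- **Pull-back of powers**: `f* (Dʳ) = (f* D)ʳ` for a morphism `f : X ⟶ Y` of smooth projective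
varieties (`map_one`, `map_cup`; Kleiman 1968, §1.2, `f*` is a ring homomorphism).
[cite: Kleiman1968, §1.2] -/
theorem pullback_pow_eq_pow_pullback {n : ℕ} {X : SchemeOver k} (hX : IsSmoothProjective n X)
    {m : ℕ} {Y : SchemeOver k} (hY : IsSmoothProjective m Y) (f : X ⟶ Y) (D : W.obj Y 2)
    (r : ℕ) :
    W.pullback f (2 * r) (W.pow Y D r) = W.pow X (W.pullback f 2 D) r := by
  induction r with
  | zero => exact W.map_one hX hY f
  | succ r ih => rw [W.pow_succ, W.pow_succ, W.map_cup hX hY f, ih]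

/-- **Pull-backs of algebraic classes are algebraic**: `f* (K · Aᵖ(Y)) ⊆ K · Aᵖ(X)` for a
morphism `f : X ⟶ Y` of smooth projective varieties (the C-lite axiom
`pullback_ratAlgebraicClasses_le`, extended `K`-linearly; Kleiman 1968, §1.2 (C)).
[cite: Kleiman1968, §1.2 (C)] -/
theorem map_algebraicClasses_le {n : ℕ} {X : SchemeOver k} (hX : IsSmoothProjective n X) {m : ℕ}
    {Y : SchemeOver k} (hY : IsSmoothProjective m Y) (f : X ⟶ Y) (p : ℕ) :
    (W.algebraicClasses Y p).map (W.pullback f (2 * p)) ≤ W.algebraicClasses X p := by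
  unfold PreWeilCohomology.algebraicClasses
  rw [Submodule.map_span, Submodule.span_le]
  rintro _ ⟨y, hy, rfl⟩
  exact W.ratAlgebraicClasses_le_algebraicClasses X p
    (W.pullback_ratAlgebraicClasses_le hX hY f p
      ⟨y, W.algebraicLattice_le_ratAlgebraicClasses Y p hy, rfl⟩)

/-- **Pull-backs of Lefschetz classes are Lefschetz classes**: `f* (Dʳ) = (f* D)ʳ` with `f* D`
again a `K`-combination of divisor classes (Milne 2009, §1.3; Kleiman 1968, §1.2).
[cite: Milne2009RationalTate, §1.3] -/
theorem map_lefschetzClasses_le {n : ℕ} {X : SchemeOver k} (hX : IsSmoothProjective n X) {m : ℕ}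
    {Y : SchemeOver k} (hY : IsSmoothProjective m Y) (f : X ⟶ Y) (r : ℕ) :
    (W.lefschetzClasses Y r).map (W.pullback f (2 * r)) ≤ W.lefschetzClasses X r := by
  unfold lefschetzClasses
  rw [Submodule.map_span, Submodule.span_le]
  rintro _ ⟨_, ⟨⟨D, hD⟩, rfl⟩, rfl⟩
  rw [SetLike.mem_coe, W.pullback_pow_eq_pow_pullback hX hY f D r]
  exact W.pow_mem_lefschetzClasses X (W.map_algebraicClasses_le hX hY f 1 ⟨D, hD, rfl⟩) r

/-- A pulled-back Lefschetz class is a Lefschetz class (element form of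
`map_lefschetzClasses_le`). [cite: Milne2009RationalTate, §1.3] -/
theorem pullback_mem_lefschetzClasses {n : ℕ} {X : SchemeOver k} (hX : IsSmoothProjective n X)
    {m : ℕ} {Y : SchemeOver k} (hY : IsSmoothProjective m Y) (f : X ⟶ Y) {r : ℕ}
    {y : W.obj Y (2 * r)} (hy : y ∈ W.lefschetzClasses Y r) :
    W.pullback f (2 * r) y ∈ W.lefschetzClasses X r :=
  W.map_lefschetzClasses_le hX hY f r ⟨y, hy, rfl⟩

/-- **Reduction along a morphism with surjective pull-back**: if `f* : H²ʳ(Y) → H²ʳ(X)` is onto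
(e.g. `f` an isogeny of abelian varieties) and every class in `H²ʳ(Y)` is a Lefschetz class,
then every class in `H²ʳ(X)` is a Lefschetz class (the reduction of Lenstra–Zarhin's statement
for `A ∼ Eᵍ` to the power `Eᵍ`). [cite: Milne2009RationalTate, §1.3] -/
theorem lefschetzClasses_eq_top_of_surjective {n : ℕ} {X : SchemeOver k}
    (hX : IsSmoothProjective n X) {m : ℕ} {Y : SchemeOver k} (hY : IsSmoothProjective m Y)
    (f : X ⟶ Y) (r : ℕ) (hf : Function.Surjective (W.pullback f (2 * r)))
    (h : W.lefschetzClasses Y r = ⊤) : W.lefschetzClasses X r = ⊤ := by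
  rw [eq_top_iff]
  rintro x -
  obtain ⟨y, rfl⟩ := hf x
  exact W.pullback_mem_lefschetzClasses hX hY f (by rw [h]; trivial)

/-! ## Abelian varieties: the degrees `r = 0`, `r > dim A`, and the zero-dimensional case -/

/-- On an abelian variety `A` (smooth projective of dimension `dim A`,
`AbelianVariety.isSmoothProjective_holds`) the Lefschetz classes exhaust `H²ʳ(A)` in the degrees
`r = 0` and `r > dim A`, for every Weil cohomology theory. [cite: Milne2009RationalTate, §1.3] -/
theorem lefschetzClasses_abelianVariety_eq_top_of_eq_zero_or_lt (A : AbelianVariety k) {r : ℕ}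
    (hr : r = 0 ∨ A.dim < r) : W.lefschetzClasses A.X r = ⊤ := by
  have hX : IsSmoothProjective A.dim A.X := AbelianVariety.isSmoothProjective_holds
  rcases hr with rfl | hr
  · exact W.lefschetzClasses_zero_eq_top hX
  · exact W.lefschetzClasses_eq_top_of_lt hX hr

end WeilCohomology

/-- **Lenstra–Zarhin for zero-dimensional abelian varieties.** A zero-dimensional abelian
variety is supersingular by convention (the empty product, `isSupersingular_of_dim_eq_zero`),
and indeed all its cohomology classes are Lefschetz classes: `H⁰ = K · 1` and `H²ʳ = 0` for
`r ≥ 1` (the case `g = 0` of Lenstra–Zarhin 1993, §1, p. 179, formal in the axioms of a Weil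
cohomology theory). [cite: LenstraZarhin1993, §1 p. 179] -/
theorem LenstraZarhin1993_supersingular_lefschetzClasses_eq_top_of_dim_eq_zero
    {k : Type u} [Field k] {K : Type v} [Field K] [CharZero K] (W : WeilCohomology k K)
    (A : AbelianVariety k) (hA : A.dim = 0) :
    LenstraZarhin1993_supersingular_lefschetzClasses_eq_top W A := by
  intro _ _ r
  refine W.lefschetzClasses_abelianVariety_eq_top_of_eq_zero_or_lt A ?_
  rcases Nat.eq_zero_or_pos r with h | h
  · exact Or.inl h
  · exact Or.inr (hA ▸ h)

namespace WeilCohomology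

variable {k : Type u} [Field k] {K : Type v} [Field K] [CharZero K] (W : WeilCohomology k K)

/-! ## The top degree -/

/-- **A hyperplane class is a `K`-combination of divisor classes**: `η = ι* cl(D)` for a
projective embedding `ι : X ↪ ℙᴺ` and an effective divisor `D` on `ℙᴺ`, and pull-backs of
algebraic classes are algebraic (`pullback_ratAlgebraicClasses_le`; `ℙᴺ` is smooth projective,
`isSmoothProjective_projectiveSpace_holds`). [cite: Kleiman1968, §1.2 (C)] -/
theorem hyperplaneClass_mem_algebraicClasses {n : ℕ} {X : SchemeOver k}
    (hX : IsSmoothProjective n X) {η : W.obj X 2} (hη : W.IsHyperplaneClass X η) :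
    η ∈ W.algebraicClasses X 1 := by
  obtain ⟨e, D, hD, -, rfl⟩ := hη
  exact W.ratAlgebraicClasses_le_algebraicClasses X 1
    (W.pullback_ratAlgebraicClasses_le hX (isSmoothProjective_projectiveSpace_holds k e.n) e.ι 1
      ⟨_, W.algebraicLattice_le_ratAlgebraicClasses _ 1 (W.cycleMap_mem_algebraicLattice _ 1 hD),
        rfl⟩)

/-- A smooth projective `X` of dimension `n ≥ 1` carries a hyperplane class `η` with `ηⁿ ≠ 0`
(`tr(ηⁿ) = deg X > 0`, Kleiman 1968, §1.2 (C), §1.4). [cite: Kleiman1968, §1.2 (C)] -/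
theorem exists_isHyperplaneClass_pow_ne_zero {n : ℕ} {X : SchemeOver k}
    (hX : IsSmoothProjective n X) (hn : 1 ≤ n) :
    ∃ η : W.obj X 2, W.IsHyperplaneClass X η ∧ W.pow X η n ≠ 0 := by
  obtain ⟨η, hη⟩ := W.isHyperplaneClass_nonempty hX hn
  obtain ⟨d, hd, htr⟩ := W.trace_pow_of_isHyperplaneClass hX η hη
  refine ⟨η, hη, fun h ↦ ?_⟩
  rw [h, map_zero] at htr
  exact (Nat.cast_ne_zero.mpr hd.ne') htr.symm

/-- **The top degree consists of Lefschetz classes**: `W.lefschetzClasses X n = ⊤` for `X`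
smooth projective of dimension `n`, since `H²ⁿ(X)` is one-dimensional (the trace is an
isomorphism) and contains the nonzero Lefschetz class `ηⁿ`, `η` a hyperplane class
(Kleiman 1968, §1.2 (A), (C)). [cite: Kleiman1968, §1.2 (C)] -/
theorem lefschetzClasses_top_eq_top {n : ℕ} {X : SchemeOver k} (hX : IsSmoothProjective n X) :
    W.lefschetzClasses X n = ⊤ := by
  rcases Nat.eq_zero_or_pos n with rfl | hn
  · exact W.lefschetzClasses_zero_eq_top hX
  obtain ⟨η, hη, hne⟩ := W.exists_isHyperplaneClass_pow_ne_zero hX hn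
  haveI := W.finite_obj hX (2 * n)
  rw [eq_top_iff]
  rintro x -
  obtain ⟨c, hc⟩ :=
    (finrank_eq_one_iff_of_nonzero' (W.pow X η n) hne).mp (W.finrank_obj_two_mul hX) x
  rw [← hc]
  exact Submodule.smul_mem _ c
    (W.pow_mem_lefschetzClasses X (W.hyperplaneClass_mem_algebraicClasses hX hη) n)

/-! ## Isogenies with a quasi-inverse -/

section QuasiInverse

open scoped MonObj

/-- **Pull-back along a morphism with a quasi-inverse is onto.** If `k`-morphisms
`f : A → B`, `g : B → A` between abelian varieties satisfy `g ∘ f = n_A` (`f ≫ g = (𝟙 A.X)^n`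
in the convolution monoid of `k`-morphisms into the group scheme `A`) with `n ≠ 0`, then
`f* : Hⁱ(B) → Hⁱ(A)` is surjective for every `i`: `f* ∘ g* = n_A* = nⁱ` on `Hⁱ(A)`
(`pullback_pow_eq_pow_smul`, Kleiman 1968, 2A; for an isogeny `f` of degree `n` such a `g`
exists, Mumford §19, remark before Thm. 1, p. 169). [cite: Kleiman1968, Appendix 2A] -/
theorem surjective_pullback_of_comp_eq_pow (A B : AbelianVariety k) (f : A.X ⟶ B.X)
    (g : B.X ⟶ A.X) {n : ℕ} (hn : n ≠ 0) (h : f ≫ g = (𝟙 A.X) ^ n) (i : ℕ) :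
    Function.Surjective (W.pullback f i) := by
  have hA : IsSmoothProjective A.dim A.X := AbelianVariety.isSmoothProjective_holds
  -- a degree-two class `w` with `w^{dim A} ≠ 0`
  obtain ⟨w, hw⟩ : ∃ w : W.obj A.X 2, W.pow A.X w A.dim ≠ 0 := by
    rcases Nat.eq_zero_or_pos A.dim with h0 | hpos
    · refine ⟨0, ?_⟩
      rw [h0, W.pow_zero]
      exact W.unit_ne_zero hA
    · obtain ⟨w, -, hw⟩ := W.exists_isHyperplaneClass_pow_ne_zero hA hpos
      exact ⟨w, hw⟩
  have hnK : ((n : K) ^ i) ≠ 0 := pow_ne_zero i (Nat.cast_ne_zero.mpr hn)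
  intro x
  refine ⟨W.pullback g i (((n : K) ^ i)⁻¹ • x), ?_⟩
  have key := W.pullback_pow_eq_pow_smul A hA hw i n (((n : K) ^ i)⁻¹ • x)
  rw [← h, W.pullback_comp, LinearMap.comp_apply] at key
  rw [key, smul_smul, mul_inv_cancel₀ hnK, one_smul]

/-- **Lefschetz classes transfer along an isogeny with a quasi-inverse**: under the hypotheses
of `surjective_pullback_of_comp_eq_pow`, if every class in `H²ʳ(B)` is a Lefschetz class then
so is every class in `H²ʳ(A)` (`lefschetzClasses_eq_top_of_surjective`) — the reduction of
Lenstra–Zarhin's statement from `A` to `Eᵍ` along an isogeny `A → Eᵍ` admitting a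
quasi-inverse. [cite: LenstraZarhin1993, §1 p. 179] -/
theorem lefschetzClasses_eq_top_of_comp_eq_pow (A B : AbelianVariety k) (f : A.X ⟶ B.X)
    (g : B.X ⟶ A.X) {n : ℕ} (hn : n ≠ 0) (h : f ≫ g = (𝟙 A.X) ^ n) (r : ℕ)
    (hB : W.lefschetzClasses B.X r = ⊤) : W.lefschetzClasses A.X r = ⊤ :=
  W.lefschetzClasses_eq_top_of_surjective AbelianVariety.isSmoothProjective_holds
    AbelianVariety.isSmoothProjective_holds f r
    (W.surjective_pullback_of_comp_eq_pow A B f g hn h (2 * r)) hB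

end QuasiInverse

end WeilCohomology

/-- **Lenstra–Zarhin for abelian varieties of dimension `≤ 1`.** For an abelian variety `A`
with `dim A ≤ 1` (a point or an elliptic curve, supersingular or not) every cohomology class is
a Lefschetz class: `H⁰ = K · 1`, `H²` is the top degree for `dim A = 1` and is spanned by `η¹`
for a hyperplane class `η` (`lefschetzClasses_top_eq_top`), and `H²ʳ = 0` beyond. This is the
case `g ≤ 1` of Lenstra–Zarhin 1993, §1, p. 179, formal in the axioms of a Weil cohomology
theory. [cite: LenstraZarhin1993, §1 p. 179] -/
theorem LenstraZarhin1993_supersingular_lefschetzClasses_eq_top_of_dim_le_one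
    {k : Type u} [Field k] {K : Type v} [Field K] [CharZero K] (W : WeilCohomology k K)
    (A : AbelianVariety k) (hA : A.dim ≤ 1) :
    LenstraZarhin1993_supersingular_lefschetzClasses_eq_top W A := by
  intro _ _ r
  have hX : IsSmoothProjective A.dim A.X := AbelianVariety.isSmoothProjective_holds
  rcases Nat.lt_or_ge A.dim r with h | h
  · exact W.lefschetzClasses_eq_top_of_lt hX h
  · rcases Nat.eq_zero_or_pos r with rfl | hr
    · exact W.lefschetzClasses_zero_eq_top hX
    · obtain rfl : r = A.dim := by omega
      exact W.lefschetzClasses_top_eq_top hX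

end Literature.AlgebraicGeometry.Motives

end
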